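import Mathlib
import HarnessLib
import Summits.NavierStokesRegularity.NavierStokesRegularity.Theorems.UnthreadedRigidityDoorUnthreadedRigidityProfileHornZonalAxis
import Summits.NavierStokesRegularity.NavierStokesRegularity.Theorems.UnthreadedRigidityDoorUnthreadedRigidityVirialHornDefs

/-!
# Route `UnthreadedRigidityDoor`, item `UnthreadedRigidity` (W2, stmt-NavierStokesRegularity-27585) — LINES g10-2 «PROFILE HORN» / g11-1 «VIRIAL HORN»:
# the degree-two dictionary — g10-2's objects ARE the `l = 2`, `Y = Y_Q` instances of g11-1's

Prover file (W2 Lean hand ns-crc-p1 g7, KEY-NS #188 (1); `--supports stmt-NavierStokesRegularity-27585 --as helper`).  The VIRIAL HORN sketch says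
«for `l = 2`, `Y = Y_Q` this is g10's `sepShell`» and lists THEOREM PHR of g10-2 among its corollaries; this file records the dictionary between the two
landed twins BY NAME so that the degree-`l` compositions of `…VirialHornCompositions` specialise to the g10-2 setting without re-typing anything:
`sepShell H Q x₀ = sepShellL H (quadY Q) x₀` (definitional), `strainAmp = strainAmpL 2`, `vortAmp = vortAmpL 2`, `HornAdmissible H → VirialAdmissible 2 H`
(the g10 decay clause is one power stronger), `IsQuadForm Q → IsSolidHarmonic 2 (quadY Q)` (a symmetric traceless form is a degree-2 solid harmonic:
`Y_Q = Σ Qᵢⱼ XᵢXⱼ` homogeneous of degree 2, `ΔY_Q = 2 tr Q = 0`), and `IsQuadForm Q → IsZonalForm Q → IsZonal (quadY Q)` (by g10-2's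
`zonal_structure`: `Y_Q = a‖y‖² + d⟪n,y⟫²`, `∇Y_Q = 2a y + 2d⟪n,y⟫ n`, `det[n, y, ∇Y_Q] = 0`).

HONEST LABEL: bookkeeping between two lines about SPECIAL separable data; `UnthreadedRigidity` (27585), W2 and NS regularity remain OPEN.  0 kit.
-/

-- the summit and its single sub-problem share the name (CONVENTIONS §1), as in every Theorems file
set_option linter.dupNamespace false

namespace Summit.NavierStokesRegularity.NavierStokesRegularity.Theorems.UnthreadedRigidity.VirialHorn

open scoped Topology InnerProductSpace
open Filter Set
open Summit.NavierStokesRegularity.NavierStokesRegularity.Theorems.UnthreadedRigidity.ProfileHorn (E3 IsQuadForm quadY discrCubic IsZonalForm sepShell HornAdmissible strainAmp vortAmp zonal_structure)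

/-- g10-2's shell is g11-1's shell with `Y = Y_Q` (definitional). -/
theorem sepShell_eq_sepShellL (H : ℝ → ℝ) (Q : Matrix (Fin 3) (Fin 3) ℝ) (x₀ : E3) :
    sepShell H Q x₀ = sepShellL H (quadY Q) x₀ := rfl

/-- `α = α₂`. -/
theorem strainAmp_eq_strainAmpL (H : ℝ → ℝ) : strainAmp H = strainAmpL 2 H := by
  funext r
  simp only [strainAmp, strainAmpL]
  norm_num

/-- `K = K₂`. -/
theorem vortAmp_eq_vortAmpL (H : ℝ → ℝ) : vortAmp H = vortAmpL 2 H := by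
  funext r
  simp only [vortAmp, vortAmpL]
  norm_num

/-- the g10-2 admissibility (decay `r⁵|H|, r⁶|H′|, r⁷|H″| ≤ C`) implies the g11-1 admissibility in degree `2` (`r⁴|H|, r⁵|H′|, r⁶|H″| ≤ C`). -/
theorem virialAdmissible_two_of_hornAdmissible {H : ℝ → ℝ} (hH : HornAdmissible H) : VirialAdmissible 2 H := by
  obtain ⟨hsm, C, hC⟩ := hH
  refine ⟨hsm, C, fun r hr => ?_⟩
  obtain ⟨h1, h2, h3⟩ := hC r hr
  have hr0 : 0 ≤ r := le_trans zero_le_one hr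
  have hp : ∀ k : ℕ, r ^ k ≤ r ^ (k + 1) := fun k => pow_le_pow_right₀ hr (Nat.le_succ k)
  refine ⟨le_trans (mul_le_mul_of_nonneg_right (hp 4) (abs_nonneg _)) h1,
    le_trans (mul_le_mul_of_nonneg_right (hp 5) (abs_nonneg _)) h2,
    le_trans (mul_le_mul_of_nonneg_right (hp 6) (abs_nonneg _)) h3⟩

/-! ## `Y_Q` is a degree-two solid harmonic -/

/-- `Y_Q` as a bilinear expression in the coordinate functionals: its derivative. -/
theorem hasFDerivAt_quadY (Q : Matrix (Fin 3) (Fin 3) ℝ) (y : E3) :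
    HasFDerivAt (quadY Q) (∑ i : Fin 3, ∑ j : Fin 3,
      ((y i * Q i j) • (EuclideanSpace.proj j : E3 →L[ℝ] ℝ) + (Q i j * y j) • (EuclideanSpace.proj i : E3 →L[ℝ] ℝ))) y := by
  have hcoord : ∀ i : Fin 3, HasFDerivAt (fun z : E3 => z i) (EuclideanSpace.proj i : E3 →L[ℝ] ℝ) y :=
    fun i => (EuclideanSpace.proj i : E3 →L[ℝ] ℝ).hasFDerivAt
  have hterm : ∀ i j : Fin 3, HasFDerivAt (fun z : E3 => z i * Q i j * z j)
      ((y i * Q i j) • (EuclideanSpace.proj j : E3 →L[ℝ] ℝ) + (Q i j * y j) • (EuclideanSpace.proj i : E3 →L[ℝ] ℝ)) y := by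
    intro i j
    have h1 : HasFDerivAt (fun z : E3 => z i * Q i j) ((Q i j) • (EuclideanSpace.proj i : E3 →L[ℝ] ℝ)) y := by
      simpa [mul_comm] using (hcoord i).mul_const (Q i j)
    have h2 := h1.mul (hcoord j)
    refine h2.congr_fderiv ?_
    ext v
    simp only [FunLike.coe_add, FunLike.coe_smul, Pi.add_apply, Pi.smul_apply, smul_eq_mul]
    ring
  unfold quadY
  have := HasFDerivAt.fun_sum fun i (_ : i ∈ Finset.univ) =>
    (HasFDerivAt.fun_sum fun j (_ : j ∈ Finset.univ) => hterm i j)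
  exact this

/-- the first directional derivative of `Y_Q` along `e k`: `∂ₖ Y_Q (z) = Σⱼ Q k j zⱼ + Σᵢ zᵢ Q i k`. -/
theorem fderiv_quadY_single (Q : Matrix (Fin 3) (Fin 3) ℝ) (z : E3) (k : Fin 3) :
    fderiv ℝ (quadY Q) z (EuclideanSpace.single k (1:ℝ)) = ∑ j : Fin 3, Q k j * z j + ∑ i : Fin 3, z i * Q i k := by
  rw [(hasFDerivAt_quadY Q z).fderiv]
  simp only [FunLike.coe_sum, Finset.sum_apply, FunLike.coe_add, FunLike.coe_smul,
    Pi.add_apply, Pi.smul_apply, smul_eq_mul]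
  simp [Finset.sum_add_distrib, Fin.sum_univ_three]
  fin_cases k <;> simp <;> ring

/-- `Y_Q` is a solid harmonic of degree `2` when `Q` is symmetric and traceless. -/
theorem isSolidHarmonic_quadY {Q : Matrix (Fin 3) (Fin 3) ℝ} (hQ : IsQuadForm Q) : IsSolidHarmonic 2 (quadY Q) := by
  refine ⟨⟨∑ i : Fin 3, ∑ j : Fin 3, MvPolynomial.C (Q i j) * (MvPolynomial.X i * MvPolynomial.X j), ?_, fun y => ?_⟩, fun y => ?_⟩
  · refine MvPolynomial.IsHomogeneous.sum _ _ 2 fun i _ => MvPolynomial.IsHomogeneous.sum _ _ 2 fun j _ => ?_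
    have hX : ((MvPolynomial.X i : MvPolynomial (Fin 3) ℝ) * MvPolynomial.X j).IsHomogeneous 2 := by
      simpa using (MvPolynomial.isHomogeneous_X ℝ i).mul (MvPolynomial.isHomogeneous_X ℝ j)
    simpa using (MvPolynomial.isHomogeneous_C (Fin 3) (Q i j)).mul hX
  · simp only [quadY, map_sum, map_mul, MvPolynomial.eval_C, MvPolynomial.eval_X]
    refine Finset.sum_congr rfl fun i _ => Finset.sum_congr rfl fun j _ => ?_
    ring
  · -- `ΔY_Q = 2 tr Q = 0`
    unfold lap3 dir2
    have hder : ∀ k : Fin 3, (fun z : E3 => fderiv ℝ (quadY Q) z (e k)) = fun z => ∑ j : Fin 3, Q k j * z j + ∑ i : Fin 3, z i * Q i k := by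
      intro k; funext z; exact fderiv_quadY_single Q z k
    simp only [hder]
    have hlin : ∀ k : Fin 3, fderiv ℝ (fun z : E3 => ∑ j : Fin 3, Q k j * z j + ∑ i : Fin 3, z i * Q i k) y (e k) = Q k k + Q k k := by
      intro k
      have hf : HasFDerivAt (fun z : E3 => ∑ j : Fin 3, Q k j * z j + ∑ i : Fin 3, z i * Q i k)
          (∑ j : Fin 3, (Q k j) • (EuclideanSpace.proj j : E3 →L[ℝ] ℝ) + ∑ i : Fin 3, (Q i k) • (EuclideanSpace.proj i : E3 →L[ℝ] ℝ)) y := by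
        refine HasFDerivAt.add ?_ ?_
        · exact HasFDerivAt.fun_sum fun j _ => by
            simpa using ((EuclideanSpace.proj j : E3 →L[ℝ] ℝ).hasFDerivAt.const_mul (Q k j))
        · exact HasFDerivAt.fun_sum fun i _ => by
            simpa [mul_comm] using ((EuclideanSpace.proj i : E3 →L[ℝ] ℝ).hasFDerivAt.mul_const (Q i k))
      rw [hf.fderiv]
      simp only [FunLike.coe_sum, Finset.sum_apply, FunLike.coe_add, FunLike.coe_smul,
        Pi.add_apply, Pi.smul_apply, smul_eq_mul, e]
      fin_cases k <;> simp
    rw [Fin.sum_univ_three, hlin 0, hlin 1, hlin 2]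
    have htr : Q.trace = 0 := hQ.2
    rw [Matrix.trace_fin_three] at htr
    linarith

/-! ## zonal forms give zonal harmonics -/

/-- the gradient of `y ↦ a‖y‖² + d⟪n,y⟫²` is `2a y + 2d⟪n,y⟫ n`. -/
theorem hasGradientAt_axisForm (a d : ℝ) (n y : E3) :
    HasGradientAt (fun y : E3 => a * ‖y‖ ^ 2 + d * ⟪n, y⟫_ℝ ^ 2) ((2 * a) • y + (2 * d * ⟪n, y⟫_ℝ) • n) y := by
  have h1 : HasFDerivAt (fun y : E3 => ‖y‖ ^ 2) (2 • innerSL ℝ y) y := by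
    simpa using (hasStrictFDerivAt_norm_sq y).hasFDerivAt
  have h2 : HasFDerivAt (fun y : E3 => ⟪n, y⟫_ℝ) (innerSL ℝ n) y := (innerSL ℝ n).hasFDerivAt
  have h3 := (h1.const_mul a).add ((h2.pow 2).const_mul d)
  rw [hasGradientAt_iff_hasFDerivAt]
  refine (h3.congr_of_eventuallyEq (Eventually.of_forall fun v => rfl)).congr_fderiv ?_
  ext v
  simp only [FunLike.coe_add, FunLike.coe_smul, Pi.add_apply, Pi.smul_apply, innerSL_apply_apply,
    smul_eq_mul, InnerProductSpace.toDual_apply_apply, inner_add_left, real_inner_smul_left]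
  push_cast
  ring

/-- a zonal symmetric form gives a zonal quadratic harmonic (axis = the axis of the form). -/
theorem isZonal_quadY {Q : Matrix (Fin 3) (Fin 3) ℝ} (hQ : IsQuadForm Q) (hz : IsZonalForm Q) : IsZonal (quadY Q) := by
  obtain ⟨n, hn, a, d, hquad⟩ := zonal_structure hQ hz
  refine ⟨n, fun h0 => by simp [h0] at hn, fun y => ?_⟩
  have hfun : quadY Q = fun y : E3 => a * ‖y‖ ^ 2 + d * ⟪n, y⟫_ℝ ^ 2 := funext hquad
  rw [hfun, (hasGradientAt_axisForm a d n y).gradient]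
  simp only [det3, PiLp.add_apply, PiLp.smul_apply, smul_eq_mul]
  ring

end Summit.NavierStokesRegularity.NavierStokesRegularity.Theorems.UnthreadedRigidity.VirialHorn
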